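import Literature.AlgebraicGeometry.Resolution.NormalCrossingsBlowupStepReductionProofs
import HarnessLib

/-!
# De Jong 1996, 7.2 (canonical strictification), step 1: the blowing up of the CANONICAL centre

Route `ResolutionOfSingularities/WildQuotients`, crux `SummitReduction`
(stmt-ResolutionOfSingularities-16324), line `FramePerfect`, stub
`stub_pair_canonicalStrictification` (de Jong 1996, 7.1–7.2: for a `G`-stable normal crossings
divisor the blow-up making it strict is intrinsic, so the action lifts and the result is
`G`-strict). Helper file 1.

The tree proves de Jong 1996, 2.4 (`DeJong1996NormalCrossingsBlowup_holds`) by blowing up, round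
after round, the top stratum `C = topStratum S Z F m` of unmarked branches of the normal crossings
divisor `Z` with marked strict part `F` (`NormalCrossingsStrictification.lean`,
`NormalCrossingsBlowupStepReduction.lean`), but its step
`DeJong1996NormalCrossingsBlowupStep` only asserts the EXISTENCE of some blowing up. For the
equivariant version we need the same conclusions for ANY blowing up `φ` of the reduced centre
`C` (then the lifted action of `BlowupsEquivariant.lean` applies) together with the explicit local
equations of `φ⁻¹(F ∪ C)` (for the bookkeeping of components). This file re-runs the étale
descent of `DeJong1996NormalCrossingsBlowupStep.of_sncBlowupTopStratum` in that form:

* `isClosed_topStratum_of_isNormalCrossingsDivisor` — the canonical centre is closed;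
* `ncBlowupTopStratum` — for any blowing up `φ : S₁ → S` of `I_C`: `φ⁻¹Z` is a normal crossings
  divisor, the bound on unmarked branches drops to `m` with respect to `φ⁻¹(F ∪ C)`, and at every
  `s₁ ∈ φ⁻¹(F ∪ C)` the ideal of `φ⁻¹(F ∪ C)` is generated by the product of the part
  `(g₀, φ^* x₁, …, φ^* x_n)` of a regular system of parameters (`g₀` a local equation of the
  exceptional divisor, dropped if a unit; `x` any regular parameters cutting out `F` at `φ s₁`),
  descended from `SNCBlowupTopStratum_holds` along the étale cover on which `Z` is strict;
* `canonicalStrictification_round` — both packaged at universe `0` (the registered sub-goal).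

## Sources

* A. J. de Jong, *Smoothness, semi-stability and alterations*, Publ. Math. IHÉS 83 (1996),
  2.4 (p. 55), 7.2 (pp. 87–88). [DeJong1996]
-/

-- single-problem summit: the doubled namespace component `ResolutionOfSingularities` is forced
set_option linter.dupNamespace false

noncomputable section

open CategoryTheory CategoryTheory.Limits AlgebraicGeometry TopologicalSpace IsLocalRing
open Literature.AlgebraicGeometry.Resolution
open Scheme.IdealSheafData

universe u

namespace Summit.ResolutionOfSingularities.ResolutionOfSingularities.Theorems

variable {S : Scheme.{u}} {Z F : Set S} {m : ℕ}

/-- **The canonical centre is closed**: for a normal crossings divisor `Z` with marked strict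
part `F ⊆ Z` and the bound `branchOrder Z ≤ branchOrder F + (m + 1)`, the top stratum
`topStratum S Z F m` is closed — its preimage under the étale surjective (hence open surjective)
cover on which `Z` becomes strict is the top stratum upstairs (`preimage_topStratum_of_etale`),
closed by `isClosed_topStratum`. (Extracted from the proof of
`DeJong1996NormalCrossingsBlowupStep.of_sncBlowupTopStratum`.) [cite: DeJong1996, 2.4, p. 55] -/
theorem isClosed_topStratum_of_isNormalCrossingsDivisor [IsLocallyNoetherian S]
    (hZ : IsNormalCrossingsDivisor S Z) (hF : IsStrictNormalCrossingsDivisor S F) (hFZ : F ⊆ Z)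
    (hb : ∀ s ∈ Z, branchOrder S Z s ≤ branchOrder S F s + (m + 1 : ℕ)) :
    IsClosed (topStratum S Z F m) := by
  obtain ⟨S', e, he, hsurj, hZ'⟩ := hZ
  haveI := he
  haveI := hsurj
  haveI : IsLocallyNoetherian S' := LocallyOfFiniteType.isLocallyNoetherian e
  have hZc : IsClosed Z := IsNormalCrossingsDivisor.isClosed ⟨S', e, he, hsurj, hZ'⟩
  have hFc : IsClosed F := hF.isClosed
  have hF' : IsStrictNormalCrossingsDivisor S' (e ⁻¹' F) := hF.preimage_of_etale e
  have hFZ' : e ⁻¹' F ⊆ e ⁻¹' Z := Set.preimage_mono hFZ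
  have hb' : ∀ s' ∈ e ⁻¹' Z,
      branchOrder S' (e ⁻¹' Z) s' ≤ branchOrder S' (e ⁻¹' F) s' + (m + 1 : ℕ) := by
    intro s' hs'
    rw [branchOrder_preimage_of_etale e hZc, branchOrder_preimage_of_etale e hFc]
    exact hb _ hs'
  have hCC' : e ⁻¹' topStratum S Z F m = topStratum S' (e ⁻¹' Z) (e ⁻¹' F) m :=
    preimage_topStratum_of_etale e hZc hFc
  exact isClosed_of_preimage_of_surjective_of_isOpenMap e.isOpenMap e.surjective
    (hCC' ▸ isClosed_topStratum hZ' hF' hFZ' hb')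

/-- **De Jong 1996, 2.4 / 7.2: one round of the canonical strictification, for ANY blowing up of
the canonical centre.** Let `S` be Noetherian, `Z ⊆ S` a normal crossings divisor, `F ⊆ Z` a
strict normal crossings divisor, `m` with `branchOrder Z ≤ branchOrder F + (m + 1)` on `Z`,
`C = topStratum S Z F m` (closed, `hC`) and `φ : S₁ → S` any blowing up of `S` in the reduced
ideal sheaf `I_C`. Then (i) `φ⁻¹Z` is a normal crossings divisor; (ii) for `s₁ ∈ φ⁻¹Z`,
`branchOrder (φ⁻¹Z) s₁ ≤ branchOrder (φ⁻¹(F ∪ C)) s₁ + m`; (iii) for `s₁ ∈ φ⁻¹(F ∪ C)`, every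
generator `g₀` of `(I_C · 𝒪_{S₁})_{s₁}` and every part `x₁, …, x_n` of a regular system of
parameters of `𝒪_{S, φ s₁}` with `I(F)_{φ s₁} = (x₁ ⋯ x_n)`: if `g₀` is a unit then
`(φ^* xᵢ)ᵢ` is part of a regular system of parameters of `𝒪_{S₁,s₁}` and
`I(φ⁻¹(F ∪ C))_{s₁} = (∏ φ^* xᵢ)`, and otherwise the same holds for `(g₀, φ^* x₁, …, φ^* x_n)`.
Proof: verbatim the étale descent of `DeJong1996NormalCrossingsBlowupStep.of_sncBlowupTopStratum`
— base change `φ` along the étale surjective `e : S' → S` making `Z` strict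
(`IsBlowup.pullback_snd_of_flat`, `comap_vanishingIdeal_of_etale`), apply
`SNCBlowupTopStratum_holds` upstairs, and descend the bound (`branchOrder_preimage_of_etale`) and
the parameters (`isRsopPart_and_stalkIdeal_eq_of_etale_square`). [cite: DeJong1996, 2.4, p. 55] -/
theorem ncBlowupTopStratum [IsNoetherian S] (hZ : IsNormalCrossingsDivisor S Z)
    (hF : IsStrictNormalCrossingsDivisor S F) (hFZ : F ⊆ Z)
    (hb : ∀ s ∈ Z, branchOrder S Z s ≤ branchOrder S F s + (m + 1 : ℕ))
    (hC : IsClosed (topStratum S Z F m)) {S₁ : Scheme.{u}} {φ : S₁ ⟶ S}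
    (hφ : IsBlowup φ (vanishingIdeal ⟨topStratum S Z F m, hC⟩)) :
    IsNormalCrossingsDivisor S₁ (φ ⁻¹' Z) ∧
    (∀ s₁ ∈ φ ⁻¹' Z, branchOrder S₁ (φ ⁻¹' Z) s₁ ≤
        branchOrder S₁ (φ ⁻¹' (F ∪ topStratum S Z F m)) s₁ + m) ∧
    ∀ s₁ ∈ φ ⁻¹' (F ∪ topStratum S Z F m), ∀ g₀ : S₁.presheaf.stalk s₁,
      stalkIdeal ((vanishingIdeal ⟨topStratum S Z F m, hC⟩).comap φ) s₁ = Ideal.span {g₀} →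
        ∀ (n : ℕ) (x₀ : Fin n → S.presheaf.stalk (φ s₁)), IsRsopPart x₀ →
          stalkIdeal (vanishingIdeal ⟨closure F, isClosed_closure⟩) (φ s₁) =
              Ideal.span {∏ i, x₀ i} →
            (IsUnit g₀ →
              IsRsopPart ((φ.stalkMap s₁).hom ∘ x₀) ∧
                stalkIdeal (vanishingIdeal
                  ⟨closure (φ ⁻¹' (F ∪ topStratum S Z F m)), isClosed_closure⟩) s₁ =
                    Ideal.span {∏ i, (φ.stalkMap s₁).hom (x₀ i)}) ∧
            (¬ IsUnit g₀ →
              IsRsopPart (Fin.cons g₀ ((φ.stalkMap s₁).hom ∘ x₀) : Fin (n + 1) → _) ∧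
                stalkIdeal (vanishingIdeal
                  ⟨closure (φ ⁻¹' (F ∪ topStratum S Z F m)), isClosed_closure⟩) s₁ =
                    Ideal.span {∏ i, (Fin.cons g₀ ((φ.stalkMap s₁).hom ∘ x₀) :
                      Fin (n + 1) → _) i}) := by
  -- adapted from `DeJong1996NormalCrossingsBlowupStep.of_sncBlowupTopStratum`
  -- (`Literature/AlgebraicGeometry/Resolution/NormalCrossingsBlowupStepReduction.lean`)
  classical
  obtain ⟨S', e, he, hsurj, hZ'⟩ := hZ
  haveI := he
  haveI := hsurj
  haveI : IsLocallyNoetherian S' := LocallyOfFiniteType.isLocallyNoetherian e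
  have hZnc : IsNormalCrossingsDivisor S Z := ⟨S', e, he, hsurj, hZ'⟩
  have hZc : IsClosed Z := hZnc.isClosed
  have hFc : IsClosed F := hF.isClosed
  have hF' : IsStrictNormalCrossingsDivisor S' (e ⁻¹' F) := hF.preimage_of_etale e
  have hFZ' : e ⁻¹' F ⊆ e ⁻¹' Z := Set.preimage_mono hFZ
  have hb' : ∀ s' ∈ e ⁻¹' Z,
      branchOrder S' (e ⁻¹' Z) s' ≤ branchOrder S' (e ⁻¹' F) s' + (m + 1 : ℕ) := by
    intro s' hs'
    rw [branchOrder_preimage_of_etale e hZc, branchOrder_preimage_of_etale e hFc]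
    exact hb _ hs'
  -- the centres
  set C : Set S := topStratum S Z F m with hCdef
  set C' : Set S' := topStratum S' (e ⁻¹' Z) (e ⁻¹' F) m with hC'def
  have hCC' : e ⁻¹' C = C' := preimage_topStratum_of_etale e hZc hFc
  have hC'c : IsClosed C' := isClosed_topStratum hZ' hF' hFZ' hb'
  have hCc : IsClosed C := hC
  -- the blowing up of `S` in `I = I_C`
  set I : S.IdealSheafData := vanishingIdeal ⟨C, hCc⟩ with hIdef
  haveI : IsLocallyNoetherian S₁ := isLocallyNoetherian_of_isBlowup hφ
  -- base change along `e`
  set φ' : pullback φ e ⟶ S' := pullback.snd φ e with hφ'def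
  set e₁ : pullback φ e ⟶ S₁ := pullback.fst φ e with he₁def
  have hsq : e₁ ≫ φ = φ' ≫ e := pullback.condition
  have hcomm : ∀ s : ↥(pullback φ e), φ (e₁ s) = e (φ' s) := fun s => by
    rw [← Scheme.Hom.comp_apply, hsq, Scheme.Hom.comp_apply]
  have hI' : I.comap e = vanishingIdeal ⟨C', hC'c⟩ := by
    rw [hIdef, comap_vanishingIdeal_of_etale]
    congr 1
    exact Closeds.ext hCC'
  have hφ' : IsBlowup φ' (vanishingIdeal ⟨C', hC'c⟩) := hI' ▸ hφ.pullback_snd_of_flat e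
  obtain ⟨hZ₁', hb₁', hpt⟩ := SNCBlowupTopStratum_holds S' _ _ m hZ' hF' hFZ' hb' hC'c _ φ' hφ'
  -- preimages
  have hpreZ : e₁ ⁻¹' (φ ⁻¹' Z) = φ' ⁻¹' (e ⁻¹' Z) := by
    ext s; simp only [Set.mem_preimage, hcomm]
  have hpreF : e₁ ⁻¹' (φ ⁻¹' (F ∪ C)) = φ' ⁻¹' (e ⁻¹' F ∪ C') := by
    ext s; simp only [Set.mem_preimage, Set.mem_union, hcomm, ← hCC']
  have hZ₁c : IsClosed (φ ⁻¹' Z) := hZc.preimage φ.continuous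
  have hF₁c : IsClosed (φ ⁻¹' (F ∪ C)) := (hFc.union hCc).preimage φ.continuous
  refine ⟨?_, ?_, ?_⟩
  · -- `φ⁻¹Z` is a normal crossings divisor: it becomes strict on `S₁ ×_S S'`
    refine ⟨pullback φ e, e₁, inferInstance, inferInstance, ?_⟩
    rw [hpreZ]
    exact hZ₁'
  · -- the bound `m` descends
    intro s₁ hs₁
    obtain ⟨s₁', rfl⟩ := e₁.surjective s₁
    rw [← branchOrder_preimage_of_etale e₁ hZ₁c, ← branchOrder_preimage_of_etale e₁ hF₁c, hpreZ,
      hpreF]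
    exact hb₁' _ (by rw [← hpreZ]; exact hs₁)
  · -- the parameters descend pointwise
    intro s₁ hs₁ g₀ hg₀ n x₀ hx₀ hIx₀
    obtain ⟨s₁', rfl⟩ := e₁.surjective s₁
    -- the data upstairs, at `s₁'`
    have hs₁' : s₁' ∈ φ' ⁻¹' (e ⁻¹' F ∪ C') := by
      rw [← hpreF]
      exact hs₁
    have hg : stalkIdeal ((vanishingIdeal ⟨C', hC'c⟩).comap φ') s₁' =
        Ideal.span {(e₁.stalkMap s₁').hom g₀} := by
      rw [← hI', ← Scheme.IdealSheafData.comap_comp, ← hsq, Scheme.IdealSheafData.comap_comp,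
        stalkIdeal_comap_eq_map_stalkMap, hg₀, Ideal.map_span, Set.image_singleton]
    set ι : S.presheaf.stalk (φ (e₁ s₁')) ⟶ S.presheaf.stalk (e (φ' s₁')) :=
      (S.presheaf.stalkCongr (Inseparable.of_eq (hcomm s₁'))).hom with hιdef
    set x : Fin n → S'.presheaf.stalk (φ' s₁') := (e.stalkMap (φ' s₁')).hom ∘ ι.hom ∘ x₀
      with hxdef
    have hx : IsRsopPart x ∧
        stalkIdeal (vanishingIdeal ⟨closure (e ⁻¹' F), isClosed_closure⟩) (φ' s₁') =
          Ideal.span {∏ i, x i} := by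
      letI := (e.stalkMap (φ' s₁')).hom.toAlgebra
      haveI := flat_stalkAlgebra e (φ' s₁')
      haveI := formallyUnramified_stalkAlgebra e (φ' s₁')
      haveI := essFiniteType_stalkAlgebra e (φ' s₁')
      haveI := isLocalHom_stalkAlgebra e (φ' s₁')
      have hι : IsRsopPart (ι.hom ∘ x₀) := hx₀.comp_stalkCongr (hcomm s₁')
      constructor
      · exact (isRsopPart_map_iff_of_etaleLocal (A := S.presheaf.stalk (e (φ' s₁')))
          (B := S'.presheaf.stalk (φ' s₁')) (ι.hom ∘ x₀)).mpr hι
      · have h1 : (⟨closure (e ⁻¹' F), isClosed_closure⟩ : Closeds S') =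
            (⟨closure F, isClosed_closure⟩ : Closeds S).preimage e.continuous := by
          apply Closeds.ext
          simp only [Closeds.coe_mk, Closeds.coe_preimage, hFc.closure_eq,
            (hFc.preimage e.continuous).closure_eq]
        rw [h1, ← comap_vanishingIdeal_of_etale, stalkIdeal_comap_eq_map_stalkMap,
          ← map_stalkCongr_stalkIdeal _ (hcomm s₁'), hIx₀, Ideal.map_span, Set.image_singleton,
          map_prod, Ideal.map_span, Set.image_singleton, map_prod]
        rfl
    have H := hpt s₁' hs₁' _ hg n x hx.1 hx.2
    exact isRsopPart_and_stalkIdeal_eq_of_etale_square φ e e₁ φ' hsq hF₁c hpreF s₁' g₀ x₀ H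

/-- **One round of the canonical strictification, packaged at universe `0`** (the form registered
as a sub-goal of stub `stub_pair_canonicalStrictification`): the canonical centre
`C = topStratum S Z F m` is closed, and for ANY blowing up `φ : S₁ → S` of its reduced ideal sheaf
the conclusions (i)–(iii) of `ncBlowupTopStratum` hold. [cite: DeJong1996, 2.4, p. 55] -/
theorem canonicalStrictification_round (S : Scheme.{0}) [IsNoetherian S] (Z F : Set S) (m : ℕ)
    (hZ : IsNormalCrossingsDivisor S Z) (hF : IsStrictNormalCrossingsDivisor S F) (hFZ : F ⊆ Z)
    (hb : ∀ s ∈ Z, branchOrder S Z s ≤ branchOrder S F s + (m + 1 : ℕ)) :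
    ∃ hC : IsClosed (topStratum S Z F m), ∀ (S₁ : Scheme.{0}) (φ : S₁ ⟶ S),
      IsBlowup φ (Scheme.IdealSheafData.vanishingIdeal ⟨topStratum S Z F m, hC⟩) →
        IsNormalCrossingsDivisor S₁ (φ.base ⁻¹' Z) ∧
        (∀ s₁ ∈ φ.base ⁻¹' Z, branchOrder S₁ (φ.base ⁻¹' Z) s₁ ≤
            branchOrder S₁ (φ.base ⁻¹' (F ∪ topStratum S Z F m)) s₁ + m) ∧
        ∀ s₁ ∈ φ.base ⁻¹' (F ∪ topStratum S Z F m), ∀ g₀ : S₁.presheaf.stalk s₁,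
          stalkIdeal ((Scheme.IdealSheafData.vanishingIdeal ⟨topStratum S Z F m, hC⟩).comap φ)
              s₁ = Ideal.span {g₀} →
            ∀ (n : ℕ) (x₀ : Fin n → S.presheaf.stalk (φ.base s₁)), IsRsopPart x₀ →
              stalkIdeal (Scheme.IdealSheafData.vanishingIdeal ⟨closure F, isClosed_closure⟩)
                  (φ.base s₁) = Ideal.span {∏ i, x₀ i} →
                (IsUnit g₀ →
                  IsRsopPart ((φ.stalkMap s₁).hom ∘ x₀) ∧
                    stalkIdeal (Scheme.IdealSheafData.vanishingIdeal
                      ⟨closure (φ.base ⁻¹' (F ∪ topStratum S Z F m)), isClosed_closure⟩) s₁ =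
                        Ideal.span {∏ i, (φ.stalkMap s₁).hom (x₀ i)}) ∧
                (¬ IsUnit g₀ →
                  IsRsopPart (Fin.cons g₀ ((φ.stalkMap s₁).hom ∘ x₀) : Fin (n + 1) → _) ∧
                    stalkIdeal (Scheme.IdealSheafData.vanishingIdeal
                      ⟨closure (φ.base ⁻¹' (F ∪ topStratum S Z F m)), isClosed_closure⟩) s₁ =
                        Ideal.span {∏ i, (Fin.cons g₀ ((φ.stalkMap s₁).hom ∘ x₀) :
                          Fin (n + 1) → _) i}) :=
  ⟨isClosed_topStratum_of_isNormalCrossingsDivisor hZ hF hFZ hb, fun _ _ hφ =>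
    ncBlowupTopStratum hZ hF hFZ hb _ hφ⟩

end Summit.ResolutionOfSingularities.ResolutionOfSingularities.Theorems

end
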